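import Mathlib
import HarnessLib
import Literature.NumberTheory.LFunctions.ZetaScrew
import Summits.RiemannHypothesis.RiemannHypothesis.Theorems.IntegerScrewGramCeiling
import Summits.RiemannHypothesis.RiemannHypothesis.Theorems.IntegerScrewArithmeticBrackets

/-!
# Route `IntegerScrew` — SHARPNESS of the arithmetic floor: no predictor on the `K` neighbours and finitely
# many hinge carriers gains more than `(S_K + Σ_{q∈P} Λ(q)²/q² + ε)/log M` (PIVOT-LAW §15.16; RH-FREE)

Companion of `IntegerScrewArithmeticFloor`: there the trial vector
`I_M − (1/log M)Σ_{k≤K}(c_k/2)I_{M−k} + (1/log M)Σ_{q∈P}(Λ(q)/(q√q))I_{⌈M/q⌉}` gains `S_K + H_P − ε` (times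
`1/log M`) on the variance of `I_M`; here, by the Gram ceiling lemma (`IntegerScrewGramCeiling`), NO choice
of coefficients on the same increments gains more than `S_K + H_P + ε`:

* `eventually_arithmetic_gain_le K P` : for every `ε > 0`, eventually in `M`, for ALL `θ : ℕ ⊕ ℕ → ℝ` with
  `θ(inl 0) = 1` (the corner `I_M`; `inl k ↦ I_{M−k}`, `inr q ↦ I_{⌈M/q⌉}`):
  `(M·2Ψ(log(M/(M−1))) − M·Σ_{i,j} θ_iθ_j ⟨I_{a_i}, I_{a_j}⟩)·log M ≤ S_K + Σ_{q∈P} Λ(q)²/q² + ε`.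

So the best gain of the «neighbours + hinge carriers» class is EXACTLY `(S_K + H_P)/log M·(1 + o(1))`
(PIVOT-LAW §15.9(i) extended by the prime-power hinges); no positivity hypothesis is needed for this
half.  Elementary; nothing here bears on the truth of RH. [Suzuki2023, (1.1), (1.4)]
-/

noncomputable section

-- D-0017: `Summit.<S>.<S>.…` is the designed namespace of a single-problem summit.
set_option linter.dupNamespace false

namespace Summit.RiemannHypothesis.RiemannHypothesis.Theorems.IntegerScrew

open Literature.NumberTheory.LFunctions Filter Finset
open scoped Topology

/-- `Σ_{k < K+1} f(k) = f(0) + Σ_{k ∈ [1,K]} f(k)`. [folklore] -/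
private theorem sum_range_succ_eq_add_sum_Icc' (K : ℕ) (f : ℕ → ℝ) :
    ∑ k ∈ Finset.range (K + 1), f k = f 0 + ∑ k ∈ Finset.Icc 1 K, f k := by
  induction K with
  | zero => simp
  | succ K ih => rw [Finset.sum_range_succ, ih, Finset.sum_Icc_succ_top (by omega), add_assoc]

/-- **SHARPNESS OF THE ARITHMETIC FLOOR.**  For `K : ℕ`, a finite set `P` of integers `≥ 2` and `ε > 0`,
eventually in `M`, for every coefficient vector `θ : ℕ ⊕ ℕ → ℝ` with `θ (inl 0) = 1` (labels
`a(inl k) = M − k`, `a(inr q) = ⌈M/q⌉ = (M + q − 1)/q`):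
`(M·2Ψ(log(M/(M−1))) − M·Σ_{i,j ∈ range(K+1) ⊕ P} θ_iθ_j·B(a_i, a_j))·log M ≤ S_K + Σ_{q∈P} Λ(q)²/q² + ε`,
`B(a,b) = Ψ(log a − log(b−1)) + Ψ(log(a−1) − log b) − Ψ(log a − log b) − Ψ(log(a−1) − log(b−1)) = ⟨I_a, I_b⟩`
— the variance reduction of `I_M` by ANY predictor on these increments is at most `(S_K + H_P + ε)/(M log M)`.
[folklore] -/
theorem eventually_arithmetic_gain_le (K : ℕ) (P : Finset ℕ) (hP : ∀ n ∈ P, 2 ≤ n)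
    (ε : ℝ) (hε : 0 < ε) :
    ∀ᶠ M : ℕ in atTop, ∀ θ : ℕ ⊕ ℕ → ℝ, θ (Sum.inl 0) = 1 →
      ((M : ℝ) * (2 * zetaScrew (Real.log ((M : ℝ) / ((M : ℝ) - 1))))
        - (M : ℝ) * ∑ i ∈ (Finset.range (K + 1)).disjSum P, ∑ j ∈ (Finset.range (K + 1)).disjSum P,
          θ i * θ j *
            (zetaScrew (Real.log ((Sum.elim (fun k : ℕ => M - k) (fun n : ℕ => (M + n - 1) / n) i : ℕ) : ℝ)
                - Real.log (((Sum.elim (fun k : ℕ => M - k) (fun n : ℕ => (M + n - 1) / n) j : ℕ) : ℝ) - 1))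
              + zetaScrew (Real.log (((Sum.elim (fun k : ℕ => M - k) (fun n : ℕ => (M + n - 1) / n) i : ℕ) : ℝ) - 1)
                - Real.log ((Sum.elim (fun k : ℕ => M - k) (fun n : ℕ => (M + n - 1) / n) j : ℕ) : ℝ))
              - zetaScrew (Real.log ((Sum.elim (fun k : ℕ => M - k) (fun n : ℕ => (M + n - 1) / n) i : ℕ) : ℝ)
                - Real.log ((Sum.elim (fun k : ℕ => M - k) (fun n : ℕ => (M + n - 1) / n) j : ℕ) : ℝ))
              - zetaScrew (Real.log (((Sum.elim (fun k : ℕ => M - k) (fun n : ℕ => (M + n - 1) / n) i : ℕ) : ℝ) - 1)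
                - Real.log (((Sum.elim (fun k : ℕ => M - k) (fun n : ℕ => (M + n - 1) / n) j : ℕ) : ℝ) - 1))))
        * Real.log (M : ℝ)
      ≤ (∑ k ∈ Finset.Icc 1 K, (-(((k : ℝ) + 1) * Real.log ((k : ℝ) + 1) - 2 * ((k : ℝ) * Real.log k)
            + ((k : ℝ) - 1) * Real.log ((k : ℝ) - 1)) / 2) ^ 2)
        + (∑ n ∈ P, (ArithmeticFunction.vonMangoldt n) ^ 2 / (n : ℝ) ^ 2) + ε := by
  classical
  set s : Finset (ℕ ⊕ ℕ) := (Finset.range (K + 1)).disjSum P with hs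
  set i₀ : ℕ ⊕ ℕ := Sum.inl 0 with hi₀def
  have hi₀ : i₀ ∈ s := Finset.inl_mem_disjSum.2 (Finset.mem_range.2 (Nat.succ_pos K))
  set lab : ℕ → ℕ ⊕ ℕ → ℕ := fun M => Sum.elim (fun k => M - k) (fun n => (M + n - 1) / n) with hlab
  set C : ℕ ⊕ ℕ → ℝ := Sum.elim
    (fun k : ℕ => -(((k : ℝ) + 1) * Real.log ((k : ℝ) + 1) - 2 * ((k : ℝ) * Real.log k)
      + ((k : ℝ) - 1) * Real.log ((k : ℝ) - 1)) / 2)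
    (fun n : ℕ => -(ArithmeticFunction.vonMangoldt n / Real.sqrt n)) with hC
  set w : ℕ ⊕ ℕ → ℝ := Sum.elim (fun _ : ℕ => (1 : ℝ)) (fun n : ℕ => (n : ℝ)) with hw
  set L : ℕ → ℝ := fun M => Real.log (M : ℝ) with hL
  set g : ℕ → (ℕ ⊕ ℕ) → (ℕ ⊕ ℕ) → ℝ := fun M i j => (M : ℝ) *
    (zetaScrew (Real.log (lab M i : ℝ) - Real.log ((lab M j : ℝ) - 1))
      + zetaScrew (Real.log ((lab M i : ℝ) - 1) - Real.log (lab M j : ℝ))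
      - zetaScrew (Real.log (lab M i : ℝ) - Real.log (lab M j : ℝ))
      - zetaScrew (Real.log ((lab M i : ℝ) - 1) - Real.log ((lab M j : ℝ) - 1))) with hg
  have hmem : ∀ i ∈ s, (∃ k, i = Sum.inl k ∧ k < K + 1) ∨ (∃ n, i = Sum.inr n ∧ n ∈ P) := by
    intro i hi
    rcases i with k | n
    · exact Or.inl ⟨k, rfl, Finset.mem_range.1 (Finset.inl_mem_disjSum.1 hi)⟩
    · exact Or.inr ⟨n, rfl, Finset.inr_mem_disjSum.1 hi⟩
  have hLT : Tendsto L atTop atTop := Real.tendsto_log_atTop.comp tendsto_natCast_atTop_atTop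
  have hsymm : ∀ M, ∀ i ∈ s, ∀ j ∈ s, g M i j = g M j i := by
    intro M i _ j _
    simp only [hg]
    rw [bracket_symm]
  have hrow : ∀ i ∈ s, i ≠ i₀ → Tendsto (fun M => g M i₀ i) atTop (𝓝 (C i)) := by
    intro i hi hne
    rcases hmem i hi with ⟨k, rfl, hk⟩ | ⟨n, rfl, hn⟩
    · have hk1 : 1 ≤ k := by
        rcases Nat.eq_zero_or_pos k with h | h
        · exact absurd (by rw [h]) hne
        · exact h
      simp only [hg, hlab, hC, hi₀def, Sum.elim_inl, Nat.sub_zero]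
      exact tendsto_cornerBracket_lag k hk1
    · simp only [hg, hlab, hC, hi₀def, Sum.elim_inl, Sum.elim_inr, Nat.sub_zero]
      exact tendsto_cornerBracket_ceil (hP n hn)
  have hdiag : ∀ i ∈ s, i ≠ i₀ → Tendsto (fun M => g M i i / L M) atTop (𝓝 (w i)) := by
    intro i hi _
    rcases hmem i hi with ⟨k, rfl, hk⟩ | ⟨n, rfl, hn⟩
    · simp only [hg, hlab, hw, hL, Sum.elim_inl]
      exact tendsto_lagBracket_self_div_log k
    · simp only [hg, hlab, hw, hL, Sum.elim_inr]
      exact tendsto_ceilBracket_self_div_log (hP n hn)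
  have hwpos : ∀ i ∈ s, i ≠ i₀ → 0 < w i := by
    intro i hi _
    rcases hmem i hi with ⟨k, rfl, hk⟩ | ⟨n, rfl, hn⟩
    · simp only [hw, Sum.elim_inl]; exact one_pos
    · simp only [hw, Sum.elim_inr]
      exact_mod_cast (by have := hP n hn; omega : 0 < n)
  have hoff : ∀ i ∈ s, ∀ j ∈ s, i ≠ i₀ → j ≠ i₀ → i ≠ j →
      ∃ B : ℝ, ∀ᶠ M in atTop, |g M i j| ≤ B := by
    intro i hi j hj _ _ hij
    rcases hmem i hi with ⟨k, rfl, hk⟩ | ⟨n, rfl, hn⟩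
    · rcases hmem j hj with ⟨k', rfl, hk'⟩ | ⟨n', rfl, hn'⟩
      · have hkk : k ≠ k' := fun h => hij (by rw [h])
        simp only [hg, hlab, Sum.elim_inl]
        exact eventually_abs_lagBracket_le hkk
      · simp only [hg, hlab, Sum.elim_inl, Sum.elim_inr]
        exact eventually_abs_lagCeilBracket_le k (hP n' hn')
    · rcases hmem j hj with ⟨k', rfl, hk'⟩ | ⟨n', rfl, hn'⟩
      · obtain ⟨B, hB⟩ := eventually_abs_lagCeilBracket_le k' (hP n hn)
        refine ⟨B, ?_⟩
        filter_upwards [hB] with M hM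
        simp only [hg, hlab, Sum.elim_inl, Sum.elim_inr]
        rw [bracket_symm]
        exact hM
      · have hnn : n ≠ n' := fun h => hij (by rw [h])
        simp only [hg, hlab, Sum.elim_inr]
        exact eventually_abs_ceilCeilBracket_le (hP n hn) (hP n' hn') hnn
  have hceil := eventually_gramCeiling s hi₀ g L C w hLT hsymm hrow hdiag hwpos hoff hε
  -- the value of the ceiling
  have hval : ∑ i ∈ s.erase i₀, C i ^ 2 / w i
      = (∑ k ∈ Finset.Icc 1 K, (-(((k : ℝ) + 1) * Real.log ((k : ℝ) + 1) - 2 * ((k : ℝ) * Real.log k)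
            + ((k : ℝ) - 1) * Real.log ((k : ℝ) - 1)) / 2) ^ 2)
        + ∑ n ∈ P, (ArithmeticFunction.vonMangoldt n) ^ 2 / (n : ℝ) ^ 2 := by
    rw [Finset.sum_erase_eq_sub hi₀, hs, Finset.sum_disjSum]
    simp only [hC, hw, hi₀def, Sum.elim_inl, Sum.elim_inr, div_one]
    have h0 : (-((((0 : ℕ) : ℝ) + 1) * Real.log (((0 : ℕ) : ℝ) + 1) - 2 * ((((0 : ℕ) : ℝ)) * Real.log ((0 : ℕ) : ℝ))
      + ((((0 : ℕ) : ℝ)) - 1) * Real.log ((((0 : ℕ) : ℝ)) - 1)) / 2 : ℝ) = 0 := by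
      simp [Real.log_neg_eq_log]
    rw [sum_range_succ_eq_add_sum_Icc', h0]
    have hP' : ∑ n ∈ P, (-(ArithmeticFunction.vonMangoldt n / Real.sqrt n)) ^ 2 / (n : ℝ)
        = ∑ n ∈ P, (ArithmeticFunction.vonMangoldt n) ^ 2 / (n : ℝ) ^ 2 := by
      refine Finset.sum_congr rfl fun n hn => ?_
      have hn0 : (0 : ℝ) < n := by exact_mod_cast (by have := hP n hn; omega : 0 < n)
      rw [neg_sq, div_pow, Real.sq_sqrt hn0.le]
      field_simp
    rw [hP']
    ring
  rw [hval] at hceil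
  filter_upwards [hceil, eventually_ge_atTop 3] with M hM hM3 θ hθ
  have hM3r : (3 : ℝ) ≤ (M : ℝ) := by exact_mod_cast hM3
  have hlab₀ : lab M i₀ = M := by simp [hlab, hi₀def]
  have hcorner : g M i₀ i₀ = (M : ℝ) * (2 * zetaScrew (Real.log ((M : ℝ) / ((M : ℝ) - 1)))) := by
    simp only [hg, hlab₀]
    rw [bracket_self, Real.log_div (by linarith : (M : ℝ) ≠ 0) (by linarith : (M : ℝ) - 1 ≠ 0)]
  have hQ : ∑ i ∈ s, ∑ j ∈ s, θ i * θ j * g M i j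
      = (M : ℝ) * ∑ i ∈ s, ∑ j ∈ s, θ i * θ j *
        (zetaScrew (Real.log (lab M i : ℝ) - Real.log ((lab M j : ℝ) - 1))
          + zetaScrew (Real.log ((lab M i : ℝ) - 1) - Real.log (lab M j : ℝ))
          - zetaScrew (Real.log (lab M i : ℝ) - Real.log (lab M j : ℝ))
          - zetaScrew (Real.log ((lab M i : ℝ) - 1) - Real.log ((lab M j : ℝ) - 1))) := by
    rw [Finset.mul_sum]
    refine Finset.sum_congr rfl fun i _ => ?_
    rw [Finset.mul_sum]
    refine Finset.sum_congr rfl fun j _ => ?_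
    simp only [hg]
    ring
  have h := hM θ (by rw [hi₀def]; exact hθ)
  rw [hcorner, hQ] at h
  simpa only [hs, hlab, hL] using h

end Summit.RiemannHypothesis.RiemannHypothesis.Theorems.IntegerScrew

end
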